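import Summits.HodgeConjecture.HodgeConjecture.Theorems.DworkReflectionQuotientsLeafOfPrimaryFacts

/-!
# Route `DworkReflectionQuotients`: the crux `GenericInvariantHodgeClasses` BY NAME modulo the two primary
# analytic facts (with the by-name status of the whole open part of the route)

Route `route-HodgeConjecture-DworkReflectionQuotients` (cell `hodge-nonav`; FRONTIER rung F-H1 — never summit
credit). Prover seat `hodge-nonav-20241-p1` (g10). SUPPORT FILE (`--supports stmt-HodgeConjecture-24129`;
CONDITIONAL results, nothing here closes an item).

Since route file rev 8 the crux item `stmt-HodgeConjecture-24129` is the route DECL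
`Summit.HodgeConjecture.HodgeConjecture.Theses.DworkReflectionQuotients.GenericInvariantHodgeClasses`; the tree
theorem `genericInvariantHodgeClasses_of_frames_of_residues` (file `DworkReflectionQuotientsGIOfPrimaryFacts`,
g9) concludes its signature verbatim. This file restates that reduction with the conclusion BY NAME
(`genericInvariantHodgeClasses_of_primaryFacts`), and records in one place the by-name status of every open
item of the route modulo the four residual print facts:

* crux K1 `ReflectionQuotientDescent` (stmt-20240) ⟸ {`DworkSextic.BiniGarbagnati2012_reflectionQuotient_isFano`
  (Bini–Garbagnati 2014 Prop. 3.20), `Motives.KollarMiyaokaMori1992_fano_rationallyChainConnected`}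
  — `reflectionQuotientDescent_of_isFano_of_KMM` (file `DworkReflectionQuotientsLeafOfPrimaryFacts`);
* crux GI `GenericInvariantHodgeClasses` (stmt-24129) ⟸ {`DworkSextic.Griffiths1968_dworkPencil_holomorphicHodgeFrames`
  (Voisin I Thm. 10.3 along the pencil), `DworkSextic.Voisin2003_dworkPencil_residues_infinitesimal` (Voisin II
  §6.1–6.2 along the pencil)} — THIS FILE;
* support `GenericHodgeClassesFlat` (stmt-20243) ⟸ all four — `genericHodgeClassesFlat_of_four_facts`;
* the rung leaf `DworkSexticHodge` ⟸ all four — `dworkSexticHodge_of_four_facts` (file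
  `DworkReflectionQuotientsLeafOfPrimaryFacts`).

Honest scope: conditional structure theorems; nothing here says HC, HC_CM or HC_AV is proved; rung F-H1 not
moved; the four named facts are refereed print theorems whose in-tree discharge is the route's residual
dependence (K1 repair census g8, GI census g9).

## References

* [VoisinHodgeI2002] C. Voisin, Hodge Theory and Complex Algebraic Geometry I (2002), Thm. 10.3.
* [VoisinHodgeII2003] C. Voisin, Hodge Theory and Complex Algebraic Geometry II (2003), §5.3, §6.1–§6.2,
  Thm. 6.24 (proof).
* [BiniGarbagnati2012] G. Bini, A. Garbagnati, Quotients of the Dwork pencil, J. Geom. Phys. 75 (2014), Prop. 3.20.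
* [KollarMiyaokaMori1992] J. Kollár, Y. Miyaoka, S. Mori, Rational connectedness and boundedness of Fano
  manifolds, J. Differential Geom. 36 (1992), Thm. 0.1.
-/

namespace Summit.HodgeConjecture.HodgeConjecture.Theorems

open Literature.AlgebraicGeometry.HodgeTheory Literature.AlgebraicGeometry.Motives

/-- **Crux GI `GenericInvariantHodgeClasses` (stmt-HodgeConjecture-24129) BY NAME from the two primary
analytic facts of the Dwork pencil** — Griffiths' holomorphic Hodge frames (Voisin I Thm. 10.3) and the
Carlson–Griffiths residues with their derivative (Voisin II §6.1–6.2): the route decl unfolds to the signature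
concluded by `genericInvariantHodgeClasses_of_frames_of_residues`. CONDITIONAL; rung F-H1 not moved.
[cite: VoisinHodgeI2002, Thm. 10.3] [cite: VoisinHodgeII2003, Thm. 6.13 and Thm. 6.24 (proof)] -/
theorem genericInvariantHodgeClasses_of_primaryFacts
    (hframes : DworkSextic.Griffiths1968_dworkPencil_holomorphicHodgeFrames)
    (hres : DworkSextic.Voisin2003_dworkPencil_residues_infinitesimal) :
    Summit.HodgeConjecture.HodgeConjecture.Theses.DworkReflectionQuotients.GenericInvariantHodgeClasses :=
  genericInvariantHodgeClasses_of_frames_of_residues hframes hres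

end Summit.HodgeConjecture.HodgeConjecture.Theorems
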